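import Mathlib.Analysis.InnerProductSpace.Calculus
import Mathlib.Analysis.Calculus.Deriv.Star
import Mathlib.Analysis.Calculus.Deriv.MeanValue
import Mathlib.Analysis.Complex.Basic
import Mathlib.Analysis.SpecialFunctions.ExpDeriv
import Mathlib.Analysis.SpecialFunctions.Sqrt
import HarnessLib

/-!
# Waleffe's single helical triad: conservation laws and the linear (in)stability of a loaded leg
# (Waleffe 1992; as restated in Alexakis–Biferale, Phys. Rep. 767–769 (2018), §4.1.1–§4.1.2)

HONEST FRAMING (cell `pub-fluidc`, seat `fclit`; D-0074): a three-mode ODE (the Navier–Stokes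
nonlinearity restricted to ONE triad of helical Fourier modes) and its linearisation about a state
with all the energy in one leg. WHAT THIS IS NOT: not a statement about Navier–Stokes turbulence
("care needs to be taken when extrapolating the stability properties of isolated triads to the
full network present in the NSE", Alexakis–Biferale p. 26) and not NS-regularity evidence. It is
the printed basis of the cell's E.2 "heterochiral trigger seed" and of the `σ_pair` screen of
PREREG-FC-TRIG-1 §3.1 (the restricted-operator growth rate of a seeded triad).

## What is printed

Alexakis–Biferale 2018, §4.1.1 [held: arXiv:1808.06186, PDF chunk p0024], after Waleffe 1992: in
the helical decomposition `ũ(k) = ũ⁺ h⁺ + ũ⁻ h⁻` the Navier–Stokes equations read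
`∂ₜ ũ^{s_k}_k = Σ_{p+q+k=0} Σ_{s_p,s_q} C^{s_k,s_p,s_q}_{k,p,q} (ũ^{s_p}_p)* (ũ^{s_q}_q)* − νk² ũ^{s_k}_k`,
`C^{s_k,s_p,s_q}_{k,p,q} = −¼ (s_q q − s_p p) [h^{s_p}_p × h^{s_q}_q · h^{s_k}_k]*`; §4.1.2 [p0026]:
"energy and helicity are conserved triad-by-triad [Waleffe 1992, 1993]" and "Waleffe analyzed the
stability properties of each single class … the homochiral class I and the heterochiral class II
are such that the intermediate wavenumber tends to loose energy toward small and large scale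
simultaneously, while class III and class IV are always such that the smallest wave number is the
most unstable … (instability hypothesis)". For one triad the three coefficients share the complex
geometric factor `g = −¼[h × h · h]*` (a cyclic triple product) and are `g` times the real numbers
`(s_p p − s_q q, s_q q − s_k k, s_k k − s_p p)` — the pattern typed (summit-side, as design
lemmas) in `Summit.NavierStokesRegularity.FluidComputer.TriadSignGeometry` up to a common sign.

## What is here (all PROVED; no named facts)

* `coeffK`, `coeffP`, `coeffQ` — Waleffe's real coefficient pattern `(s_p p − s_q q, s_q q − s_k k, s_k k − s_p p)`; `coeff_sum` (energy:
  `C_k + C_p + C_q = 0`), `coeff_helicity_sum` (`s_k k C_k + s_p p C_p + s_q q C_q = 0`).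
* `IsHelicalTriad Ck Cp Cq g uk up uq` — the inviscid single-triad system
  `u̇_k = C_k g ū_p ū_q`, `u̇_p = C_p g ū_q ū_k`, `u̇_q = C_q g ū_k ū_p` for complex amplitudes
  `ℝ → ℂ`; **`energy_conservation`** (`|u_k|² + |u_p|² + |u_q|²` constant when `C_k + C_p + C_q = 0`),
  **`helicity_conservation`** (`Σ s k |u|²` constant when `Σ s k C = 0`), `isHelicalTriad_loaded`
  (the loaded leg `(A, 0, 0)` is a steady state).
* `IsLinearisedTriad Cp Cq G bp bq` — the linearisation about the loaded leg `u_k ≡ A`: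
  `ḃ_p = C_p G b̄_q`, `ḃ_q = C_q G b̄_p` with `G = g Ā`; **`quadForm_eq`** (the conserved form
  `C_q |b_p|² − C_p |b_q|²`), **`bounded_of_coeff_mul_neg`** (`C_p C_q < 0` ⇒ both amplitudes
  bounded for all time: the loaded leg is linearly STABLE), **`isLinearisedTriad_growing`**
  (`C_p C_q > 0` ⇒ the explicit solution growing like `e^{σt}` with
  **`σ = |G| √(C_p C_q)`** = `growthRate`, the "σ_pair" of the cell's screen), `growthRate_pos`,
  `hasDerivAt_deriv` (`b̈_p = C_p C_q |G|² b_p`).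
* Waleffe's class statements from the signs, for unit helicity signs and energy loaded in leg
  `k`: **`coeff_mul_neg_of_largest`** (`k` the largest modulus ⇒ `C_p C_q < 0`: "the largest
  wavenumber is never unstable"), **`coeff_mul_pos_iff_of_smallest`** (`k` the smallest ⇒
  unstable iff the two larger legs are heterochiral, classes III–IV), **`coeff_mul_pos_iff_of_middle`**
  (`k` the intermediate ⇒ unstable iff `k` is homochiral with the largest leg, classes I–II).
* §5 **Viscosity** (the `−νk²ũ` term of the helical NSE kept): `IsDampedLinearisedTriad Cp Cq G μp μq`
  (`ḃ_p = C_p G b̄_q − μ_p b_p`, `ḃ_q = C_q G b̄_p − μ_q b_q`, `μ = ν|leg|²`), `undamped`/`damped`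
  (equal damping decouples exactly: `b ↦ e^{∓μt} b`), the **sharp weighted-energy ceiling**
  **`IsDampedLinearisedTriad.weightedEnergy_le_exp`**
  (`C_q|b_p|² + C_p|b_q|² ≤ E(0) e^{2(σ−μ)t}` when both legs are damped at rate `≥ μ`; inviscid
  case `IsLinearisedTriad.weightedEnergy_le_exp`: nothing outgrows `σ`), its SUB-VISCOUS corollary
  `weightedEnergy_le_of_subviscous` (`σ ≤ μ` ⇒ no linear growth), the damped rate
  `dampedGrowthRate` `λ = −(μ_p+μ_q)/2 + √(σ² + (μ_p−μ_q)²/4)` with its dispersion relation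
  `(λ+μ_p)(λ+μ_q) = σ²`, `dampedGrowthRate_of_eq` (`λ(μ,μ) = σ − μ`), the **viscous threshold**
  `dampedGrowthRate_pos_iff` (`λ > 0 ↔ μ_p μ_q < σ²`) and the explicit damped exponential solution
  `isDampedLinearisedTriad_growing`. These are the inequalities behind the cell's pre-registered
  channel words (PREREG-FC-TRIG-1 §6: SUB-VISCOUS `σ_pair ≤ ν|p|²`, SLOW/LIVE by the linear factor
  `exp(2(σ_pair − ν|p|²)(t_read − t_inj))`) — typed here as theorems about the ODE, not about any run.
* §6 the cell's E.2 seed geometry `(N; 2N, 2N)` made quantitative: `coeff_mul_isosceles_heterochiral`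
  (`C_pC_q = 3N²`), `coeff_mul_isosceles_homochiral` (`= −(2s_q − s_k)²N² ≤ 0`: stable),
  `growthRate_isosceles_heterochiral` (`σ_pair = √3|N||G|`), `dampedGrowthRate_isosceles_heterochiral`
  (`λ = √3|N||G| − 4νN²`: SUB-VISCOUS iff `√3|N||G| ≤ 4νN²`).

## References

* A. Alexakis, L. Biferale, *Cascades and transitions in turbulent flows*, Phys. Rep. 767–769
  (2018) 1–101 = arXiv:1808.06186, §4.1.1 (helical NSE, coefficient `C`), §4.1.2 (triad classes,
  Waleffe's instability assumption). [`AlexakisBiferale2018`]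
* F. Waleffe, *The nature of triad interactions in homogeneous turbulence*, Phys. Fluids A 4 (1992)
  350–363 (primary; cite-only, acq-03703). [`Waleffe1992`]
-/

noncomputable section

open Real Complex
open scoped RealInnerProductSpace ComplexConjugate

namespace Literature.Analysis.FluidPDE

namespace HelicalTriad

/-! ### §1 Waleffe's coefficient pattern -/

/-- Coefficient of the `k`-leg of the triad `(k, p, q)` with helicity signs `(s_k, s_p, s_q)`:
`s_p p − s_q q` (times the common geometric factor `g`; it involves only the OTHER two legs).
[cite: AlexakisBiferale2018, §4.1.1] -/
def coeffK (sp sq p q : ℝ) : ℝ := sp * p - sq * q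
/-- Coefficient of the `p`-leg: `s_q q − s_k k`. [cite: AlexakisBiferale2018, §4.1.1] -/
def coeffP (sk sq k q : ℝ) : ℝ := sq * q - sk * k
/-- Coefficient of the `q`-leg: `s_k k − s_p p`. [cite: AlexakisBiferale2018, §4.1.1] -/
def coeffQ (sk sp k p : ℝ) : ℝ := sk * k - sp * p

/-- **Energy is conserved triad by triad**: the coefficients sum to zero.
[cite: AlexakisBiferale2018, §4.1.2] -/
theorem coeff_sum (sk sp sq k p q : ℝ) :
    coeffK sp sq p q + coeffP sk sq k q + coeffQ sk sp k p = 0 := by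
  simp only [coeffK, coeffP, coeffQ]; ring

/-- **Helicity is conserved triad by triad**: `s_k k C_k + s_p p C_p + s_q q C_q = 0`.
[cite: AlexakisBiferale2018, §4.1.2] -/
theorem coeff_helicity_sum (sk sp sq k p q : ℝ) :
    sk * k * coeffK sp sq p q + sp * p * coeffP sk sq k q +
      sq * q * coeffQ sk sp k p = 0 := by
  simp only [coeffK, coeffP, coeffQ]; ring

/-! ### §2 The single-triad system and its invariants -/

/-- **The inviscid single-triad helical system** (Alexakis–Biferale (4.x) restricted to one triad
`k + p + q = 0` and one choice of helicity signs): `u̇_k = C_k g ū_p ū_q`, `u̇_p = C_p g ū_q ū_k`,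
`u̇_q = C_q g ū_k ū_p`, with real leg coefficients and a common complex geometric factor `g`.
[cite: AlexakisBiferale2018, §4.1.1] -/
structure IsHelicalTriad (Ck Cp Cq : ℝ) (g : ℂ) (uk up uq : ℝ → ℂ) : Prop where
  /-- `u̇_k = C_k g ū_p ū_q` -/
  hasDerivAt_k : ∀ t, HasDerivAt uk ((Ck : ℂ) * g * conj (up t) * conj (uq t)) t
  /-- `u̇_p = C_p g ū_q ū_k` -/
  hasDerivAt_p : ∀ t, HasDerivAt up ((Cp : ℂ) * g * conj (uq t) * conj (uk t)) t
  /-- `u̇_q = C_q g ū_k ū_p` -/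
  hasDerivAt_q : ∀ t, HasDerivAt uq ((Cq : ℂ) * g * conj (uk t) * conj (up t)) t

/-- `d/dt |f|² = 2 Re(f' f̄)` for a complex curve. [folklore] -/
private theorem hasDerivAt_norm_sq {f : ℝ → ℂ} {f' : ℂ} {t : ℝ} (hf : HasDerivAt f f' t) :
    HasDerivAt (fun s => ‖f s‖ ^ 2) (2 * (f' * conj (f t)).re) t := by
  have h := hf.inner ℝ hf
  have e : (fun s => ‖f s‖ ^ 2) = fun s => ⟪f s, f s⟫ := by
    funext s; rw [real_inner_self_eq_norm_sq]
  rw [e]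
  refine h.congr_deriv ?_
  simp only [Complex.inner]
  have : (f t * conj f').re = (f' * conj (f t)).re := by
    rw [← Complex.conj_re (f t * conj f'), map_mul, Complex.conj_conj, mul_comm]
  rw [this]; ring

namespace IsHelicalTriad

variable {Ck Cp Cq : ℝ} {g : ℂ} {uk up uq : ℝ → ℂ}

/-- The three energy rates are `C_leg` times ONE common real number `2 Re(g ū_k ū_p ū_q)`
(detailed conservation). [cite: AlexakisBiferale2018, §4.1.2] -/
theorem hasDerivAt_energies (h : IsHelicalTriad Ck Cp Cq g uk up uq) (t : ℝ) :
    HasDerivAt (fun s => ‖uk s‖ ^ 2)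
        (Ck * (2 * (g * conj (uk t) * conj (up t) * conj (uq t)).re)) t ∧
      HasDerivAt (fun s => ‖up s‖ ^ 2)
        (Cp * (2 * (g * conj (uk t) * conj (up t) * conj (uq t)).re)) t ∧
      HasDerivAt (fun s => ‖uq s‖ ^ 2)
        (Cq * (2 * (g * conj (uk t) * conj (up t) * conj (uq t)).re)) t := by
  refine ⟨(hasDerivAt_norm_sq (h.hasDerivAt_k t)).congr_deriv ?_,
    (hasDerivAt_norm_sq (h.hasDerivAt_p t)).congr_deriv ?_,
    (hasDerivAt_norm_sq (h.hasDerivAt_q t)).congr_deriv ?_⟩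
  · have : (Ck : ℂ) * g * conj (up t) * conj (uq t) * conj (uk t) =
        (Ck : ℂ) * (g * conj (uk t) * conj (up t) * conj (uq t)) := by ring
    rw [this, Complex.re_ofReal_mul]; ring
  · have : (Cp : ℂ) * g * conj (uq t) * conj (uk t) * conj (up t) =
        (Cp : ℂ) * (g * conj (uk t) * conj (up t) * conj (uq t)) := by ring
    rw [this, Complex.re_ofReal_mul]; ring
  · have : (Cq : ℂ) * g * conj (uk t) * conj (up t) * conj (uq t) =
        (Cq : ℂ) * (g * conj (uk t) * conj (up t) * conj (uq t)) := by ring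
    rw [this, Complex.re_ofReal_mul]; ring

/-- **Energy conservation in one triad**: `|u_k|² + |u_p|² + |u_q|²` is constant when
`C_k + C_p + C_q = 0` (as for Waleffe's pattern, `coeff_sum`). [cite: AlexakisBiferale2018, §4.1.2] -/
theorem energy_conservation (h : IsHelicalTriad Ck Cp Cq g uk up uq) (hsum : Ck + Cp + Cq = 0)
    (t : ℝ) :
    ‖uk t‖ ^ 2 + ‖up t‖ ^ 2 + ‖uq t‖ ^ 2 = ‖uk 0‖ ^ 2 + ‖up 0‖ ^ 2 + ‖uq 0‖ ^ 2 := by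
  have hd : ∀ s, HasDerivAt (fun s => ‖uk s‖ ^ 2 + ‖up s‖ ^ 2 + ‖uq s‖ ^ 2) 0 s := fun s => by
    obtain ⟨h1, h2, h3⟩ := h.hasDerivAt_energies s
    refine ((h1.add h2).add h3).congr_deriv ?_
    rw [← add_mul, ← add_mul, hsum, zero_mul]
  exact is_const_of_deriv_eq_zero (fun s => (hd s).differentiableAt) (fun s => (hd s).deriv) t 0

/-- **Helicity conservation in one triad**: `s_k k |u_k|² + s_p p |u_p|² + s_q q |u_q|²` is
constant when `s_k k C_k + s_p p C_p + s_q q C_q = 0` (`coeff_helicity_sum`).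
[cite: AlexakisBiferale2018, §4.1.2] -/
theorem helicity_conservation (h : IsHelicalTriad Ck Cp Cq g uk up uq) {sk sp sq k p q : ℝ}
    (hsum : sk * k * Ck + sp * p * Cp + sq * q * Cq = 0) (t : ℝ) :
    sk * k * ‖uk t‖ ^ 2 + sp * p * ‖up t‖ ^ 2 + sq * q * ‖uq t‖ ^ 2 =
      sk * k * ‖uk 0‖ ^ 2 + sp * p * ‖up 0‖ ^ 2 + sq * q * ‖uq 0‖ ^ 2 := by
  have hd : ∀ s, HasDerivAt
      (fun s => sk * k * ‖uk s‖ ^ 2 + sp * p * ‖up s‖ ^ 2 + sq * q * ‖uq s‖ ^ 2) 0 s := fun s => by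
    obtain ⟨h1, h2, h3⟩ := h.hasDerivAt_energies s
    refine (((h1.const_mul (sk * k)).add (h2.const_mul (sp * p))).add
      (h3.const_mul (sq * q))).congr_deriv ?_
    have e : sk * k * (Ck * (2 * (g * conj (uk s) * conj (up s) * conj (uq s)).re)) +
        sp * p * (Cp * (2 * (g * conj (uk s) * conj (up s) * conj (uq s)).re)) +
        sq * q * (Cq * (2 * (g * conj (uk s) * conj (up s) * conj (uq s)).re)) =
        (sk * k * Ck + sp * p * Cp + sq * q * Cq) *
          (2 * (g * conj (uk s) * conj (up s) * conj (uq s)).re) := by ring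
    rw [e, hsum, zero_mul]
  exact is_const_of_deriv_eq_zero (fun s => (hd s).differentiableAt) (fun s => (hd s).deriv) t 0

end IsHelicalTriad

/-- **The loaded leg is a steady state**: all the energy in ONE leg, `(u_k, u_p, u_q) = (A, 0, 0)`,
solves the triad system (the state whose stability Waleffe analyses).
[cite: AlexakisBiferale2018, §4.1.2] -/
theorem isHelicalTriad_loaded (Ck Cp Cq : ℝ) (g A : ℂ) :
    IsHelicalTriad Ck Cp Cq g (fun _ => A) (fun _ => 0) (fun _ => 0) where
  hasDerivAt_k t := by simpa using hasDerivAt_const t A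
  hasDerivAt_p t := by simpa using hasDerivAt_const t (0 : ℂ)
  hasDerivAt_q t := by simpa using hasDerivAt_const t (0 : ℂ)

/-! ### §3 Linear stability of the loaded leg -/

/-- **The triad linearised about the loaded leg `u_k ≡ A`**: the perturbations of the two empty
legs obey `ḃ_p = C_p G b̄_q`, `ḃ_q = C_q G b̄_p` with `G = g Ā` (the `k`-leg decouples at first
order). [cite: AlexakisBiferale2018, §4.1.2] -/
structure IsLinearisedTriad (Cp Cq : ℝ) (G : ℂ) (bp bq : ℝ → ℂ) : Prop where
  /-- `ḃ_p = C_p G b̄_q` -/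
  hasDerivAt_p : ∀ t, HasDerivAt bp ((Cp : ℂ) * G * conj (bq t)) t
  /-- `ḃ_q = C_q G b̄_p` -/
  hasDerivAt_q : ∀ t, HasDerivAt bq ((Cq : ℂ) * G * conj (bp t)) t

/-- The linearisation IS the triad system with the loaded leg frozen at `A` (`G = g Ā`): the `p`-
and `q`-equations of `IsHelicalTriad` with `u_k ≡ A` are exactly `IsLinearisedTriad`.
[cite: AlexakisBiferale2018, §4.1.2] -/
theorem isLinearisedTriad_iff_frozen (Cp Cq : ℝ) (g A : ℂ) (bp bq : ℝ → ℂ) :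
    IsLinearisedTriad Cp Cq (g * conj A) bp bq ↔
      (∀ t, HasDerivAt bp ((Cp : ℂ) * g * conj (bq t) * conj A) t) ∧
        (∀ t, HasDerivAt bq ((Cq : ℂ) * g * conj A * conj (bp t)) t) := by
  constructor
  · intro h
    exact ⟨fun t => (h.hasDerivAt_p t).congr_deriv (by ring),
      fun t => (h.hasDerivAt_q t).congr_deriv (by ring)⟩
  · rintro ⟨hp, hq⟩
    exact ⟨fun t => (hp t).congr_deriv (by ring), fun t => (hq t).congr_deriv (by ring)⟩

namespace IsLinearisedTriad

variable {Cp Cq : ℝ} {G : ℂ} {bp bq : ℝ → ℂ}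

/-- **The conserved quadratic form of the linearised triad**: `C_q |b_p|² − C_p |b_q|²` is
constant. [cite: AlexakisBiferale2018, §4.1.2] -/
theorem quadForm_eq (h : IsLinearisedTriad Cp Cq G bp bq) (t : ℝ) :
    Cq * ‖bp t‖ ^ 2 - Cp * ‖bq t‖ ^ 2 = Cq * ‖bp 0‖ ^ 2 - Cp * ‖bq 0‖ ^ 2 := by
  have hd : ∀ s, HasDerivAt (fun s => Cq * ‖bp s‖ ^ 2 - Cp * ‖bq s‖ ^ 2) 0 s := fun s => by
    have h1 := (hasDerivAt_norm_sq (h.hasDerivAt_p s)).const_mul Cq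
    have h2 := (hasDerivAt_norm_sq (h.hasDerivAt_q s)).const_mul Cp
    refine (h1.sub h2).congr_deriv ?_
    have e1 : ((Cp : ℂ) * G * conj (bq s) * conj (bp s)).re =
        Cp * (G * conj (bq s) * conj (bp s)).re := by
      rw [show (Cp : ℂ) * G * conj (bq s) * conj (bp s) = (Cp : ℂ) * (G * conj (bq s) * conj (bp s))
        by ring, Complex.re_ofReal_mul]
    have e2 : ((Cq : ℂ) * G * conj (bp s) * conj (bq s)).re =
        Cq * (G * conj (bq s) * conj (bp s)).re := by
      rw [show (Cq : ℂ) * G * conj (bp s) * conj (bq s) = (Cq : ℂ) * (G * conj (bq s) * conj (bp s))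
        by ring, Complex.re_ofReal_mul]
    rw [e1, e2]; ring
  exact is_const_of_deriv_eq_zero (fun s => (hd s).differentiableAt) (fun s => (hd s).deriv) t 0

/-- **Opposite-sign coefficients: the loaded leg is linearly STABLE.** If `C_p C_q < 0` the
conserved form is definite and both perturbation amplitudes stay bounded for all times:
`|C_q| |b_p(t)|² ≤ |C_q| |b_p(0)|² + |C_p| |b_q(0)|²` and likewise for `b_q`.
[cite: AlexakisBiferale2018, §4.1.2] -/
theorem bounded_of_coeff_mul_neg (h : IsLinearisedTriad Cp Cq G bp bq) (hC : Cp * Cq < 0) (t : ℝ) :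
    |Cq| * ‖bp t‖ ^ 2 ≤ |Cq| * ‖bp 0‖ ^ 2 + |Cp| * ‖bq 0‖ ^ 2 ∧
      |Cp| * ‖bq t‖ ^ 2 ≤ |Cq| * ‖bp 0‖ ^ 2 + |Cp| * ‖bq 0‖ ^ 2 := by
  have hq := h.quadForm_eq t
  rcases lt_or_gt_of_ne (show Cp ≠ 0 by rintro rfl; simp at hC) with hp | hp
  · have hq' : 0 < Cq := by nlinarith
    rw [abs_of_neg hp, abs_of_pos hq']
    constructor <;>
      nlinarith [sq_nonneg ‖bp t‖, sq_nonneg ‖bq t‖, sq_nonneg ‖bp 0‖, sq_nonneg ‖bq 0‖,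
        mul_nonneg (neg_nonneg.2 hp.le) (sq_nonneg ‖bq t‖)]
  · have hq' : Cq < 0 := by nlinarith
    rw [abs_of_pos hp, abs_of_neg hq']
    constructor <;>
      nlinarith [sq_nonneg ‖bp t‖, sq_nonneg ‖bq t‖, sq_nonneg ‖bp 0‖, sq_nonneg ‖bq 0‖,
        mul_nonneg hp.le (sq_nonneg ‖bq t‖)]

/-- **Second-order form**: `b̈_p = C_p C_q |G|² b_p`. [cite: AlexakisBiferale2018, §4.1.2] -/
theorem hasDerivAt_deriv (h : IsLinearisedTriad Cp Cq G bp bq) (t : ℝ) :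
    HasDerivAt (deriv bp) (((Cp * Cq * ‖G‖ ^ 2 : ℝ) : ℂ) * bp t) t := by
  have e : deriv bp = fun s => (Cp : ℂ) * G * conj (bq s) := funext fun s => (h.hasDerivAt_p s).deriv
  rw [e]
  have hc : HasDerivAt (fun s => conj (bq s)) (conj ((Cq : ℂ) * G * conj (bp t))) t := by
    simpa using (h.hasDerivAt_q t).star
  refine (hc.const_mul ((Cp : ℂ) * G)).congr_deriv ?_
  simp only [map_mul, Complex.conj_ofReal, Complex.conj_conj]
  have hGG : ((‖G‖ : ℂ)) ^ 2 = G * conj G := by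
    rw [← Complex.ofReal_pow, Complex.mul_conj, Complex.normSq_eq_norm_sq]
  push_cast
  rw [hGG]
  ring

end IsLinearisedTriad

/-- **The linear growth rate of a loaded triad**: `σ = |G| √(C_p C_q)` (`G = g Ā`): the restricted
-operator growth rate of the two empty legs when `C_p C_q > 0` (the cell's "σ_pair").
[cite: AlexakisBiferale2018, §4.1.2] -/
def growthRate (Cp Cq : ℝ) (G : ℂ) : ℝ := ‖G‖ * Real.sqrt (Cp * Cq)

/-- The growth rate is positive in the unstable case `C_p C_q > 0`, `G ≠ 0`.
[cite: AlexakisBiferale2018, §4.1.2] -/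
theorem growthRate_pos {Cp Cq : ℝ} {G : ℂ} (hC : 0 < Cp * Cq) (hG : G ≠ 0) :
    0 < growthRate Cp Cq G :=
  mul_pos (norm_pos_iff.2 hG) (Real.sqrt_pos.2 hC)

/-- `σ² = C_p C_q |G|²`. [cite: AlexakisBiferale2018, §4.1.2] -/
theorem growthRate_sq {Cp Cq : ℝ} (G : ℂ) (hC : 0 ≤ Cp * Cq) :
    growthRate Cp Cq G ^ 2 = Cp * Cq * ‖G‖ ^ 2 := by
  rw [growthRate, mul_pow, Real.sq_sqrt hC]; ring

/-- **Same-sign coefficients: the loaded leg is linearly UNSTABLE.** For `C_p C_q > 0` and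
`G ≠ 0` the linearised triad has the explicit solution `b_p(t) = e^{σt}`,
`b_q(t) = (σ /(C_p Ḡ)) e^{σt}` growing at the rate `σ = |G| √(C_p C_q)` — energy leaves the
loaded leg exponentially into BOTH other legs. [cite: AlexakisBiferale2018, §4.1.2] -/
theorem isLinearisedTriad_growing {Cp Cq : ℝ} {G : ℂ} (hC : 0 < Cp * Cq) (hG : G ≠ 0) :
    IsLinearisedTriad Cp Cq G (fun t => ((Real.exp (growthRate Cp Cq G * t) : ℝ) : ℂ))
      (fun t => ((growthRate Cp Cq G : ℝ) : ℂ) / ((Cp : ℂ) * conj G) *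
        ((Real.exp (growthRate Cp Cq G * t) : ℝ) : ℂ)) := by
  set σ := growthRate Cp Cq G with hσ
  have hCp : (Cp : ℂ) ≠ 0 := by
    have : Cp ≠ 0 := by rintro rfl; simp at hC
    exact_mod_cast this
  have hGc : conj G ≠ 0 := by simpa using hG
  have hden : (Cp : ℂ) * conj G ≠ 0 := mul_ne_zero hCp hGc
  have hσ2 : ((σ : ℝ) : ℂ) * σ = (Cp : ℂ) * Cq * (G * conj G) := by
    have h2 : σ ^ 2 = Cp * Cq * ‖G‖ ^ 2 := growthRate_sq G hC.le
    have : ((σ ^ 2 : ℝ) : ℂ) = ((Cp * Cq * ‖G‖ ^ 2 : ℝ) : ℂ) := by rw [h2]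
    push_cast at this
    rw [sq] at this
    rw [this, Complex.mul_conj, Complex.normSq_eq_norm_sq]
    push_cast; ring
  have he : ∀ t, HasDerivAt (fun s => ((Real.exp (σ * s) : ℝ) : ℂ))
      (((Real.exp (σ * t) * σ : ℝ) : ℂ)) t := fun t => by
    have h := ((hasDerivAt_id t).const_mul σ).exp
    simpa [mul_comm] using h.ofReal_comp
  refine ⟨fun t => (he t).congr_deriv ?_, fun t => ((he t).const_mul _).congr_deriv ?_⟩
  · -- `σ e^{σt} = C_p G conj(b_q)`
    simp only [map_mul, map_div₀, Complex.conj_ofReal, Complex.conj_conj]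
    rw [Complex.ofReal_mul]
    field_simp
  · -- `(σ/(C_p Ḡ)) σ e^{σt} = C_q G conj(b_p)`
    simp only [Complex.conj_ofReal]
    rw [Complex.ofReal_mul]
    field_simp
    linear_combination hσ2

/-! ### §4 Waleffe's classes from the signs -/

section Signs

variable {sk sp sq k p q : ℝ}

/-- **"The largest wavenumber is never the unstable one"**: if the loaded leg `k` has strictly the
largest modulus, `C_p C_q < 0` for every choice of helicity signs, so by
`IsLinearisedTriad.bounded_of_coeff_mul_neg` the state is linearly stable.
[cite: AlexakisBiferale2018, §4.1.2] -/
theorem coeff_mul_neg_of_largest (hp : 0 < p) (hq : 0 < q) (hpk : p < k) (hqk : q < k)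
    (hsk : sk = 1 ∨ sk = -1) (hsp : sp = 1 ∨ sp = -1) (hsq : sq = 1 ∨ sq = -1) :
    coeffP sk sq k q * coeffQ sk sp k p < 0 := by
  have h1 : 0 < (k - q) * (k - p) := mul_pos (by linarith) (by linarith)
  have h2 : 0 < (k - q) * (k + p) := mul_pos (by linarith) (by linarith)
  have h3 : 0 < (k + q) * (k - p) := mul_pos (by linarith) (by linarith)
  have h4 : 0 < (k + q) * (k + p) := mul_pos (by linarith) (by linarith)
  rcases hsk with rfl | rfl <;> rcases hsp with rfl | rfl <;> rcases hsq with rfl | rfl <;>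
    simp only [coeffP, coeffQ] <;> nlinarith

/-- **Classes III–IV: the smallest leg is unstable iff the two larger legs are HETEROCHIRAL.** If
the loaded leg `k` has strictly the smallest modulus, `C_p C_q > 0 ↔ s_p ≠ s_q`.
[cite: AlexakisBiferale2018, §4.1.2] -/
theorem coeff_mul_pos_iff_of_smallest (hk : 0 < k) (hkp : k < p) (hkq : k < q)
    (hsk : sk = 1 ∨ sk = -1) (hsp : sp = 1 ∨ sp = -1) (hsq : sq = 1 ∨ sq = -1) :
    0 < coeffP sk sq k q * coeffQ sk sp k p ↔ sp ≠ sq := by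
  have h1 : 0 < (q - k) * (p - k) := mul_pos (by linarith) (by linarith)
  have h2 : 0 < (q - k) * (p + k) := mul_pos (by linarith) (by linarith)
  have h3 : 0 < (q + k) * (p - k) := mul_pos (by linarith) (by linarith)
  have h4 : 0 < (q + k) * (p + k) := mul_pos (by linarith) (by linarith)
  rcases hsk with rfl | rfl <;> rcases hsp with rfl | rfl <;> rcases hsq with rfl | rfl
  all_goals simp only [coeffP, coeffQ]
  all_goals norm_num
  all_goals nlinarith

/-- **Classes I–II: the intermediate leg is unstable iff it is HOMOCHIRAL with the largest leg.**
If the loaded leg `k` lies strictly between `p < k < q`, `C_p C_q > 0 ↔ s_k = s_q`.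
[cite: AlexakisBiferale2018, §4.1.2] -/
theorem coeff_mul_pos_iff_of_middle (hp : 0 < p) (hpk : p < k) (hkq : k < q)
    (hsk : sk = 1 ∨ sk = -1) (hsp : sp = 1 ∨ sp = -1) (hsq : sq = 1 ∨ sq = -1) :
    0 < coeffP sk sq k q * coeffQ sk sp k p ↔ sk = sq := by
  have h1 : 0 < (q - k) * (k - p) := mul_pos (by linarith) (by linarith)
  have h2 : 0 < (q - k) * (k + p) := mul_pos (by linarith) (by linarith)
  have h3 : 0 < (q + k) * (k - p) := mul_pos (by linarith) (by linarith)
  have h4 : 0 < (q + k) * (k + p) := mul_pos (by linarith) (by linarith)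
  rcases hsk with rfl | rfl <;> rcases hsp with rfl | rfl <;> rcases hsq with rfl | rfl
  all_goals simp only [coeffP, coeffQ]
  all_goals norm_num
  all_goals nlinarith

end Signs

/-! ### §5 Viscosity: the damped linearised triad, the sharp energy ceiling, and `σ_pair` against `ν|p|²` -/

/-- **The linearised triad WITH the viscous term of the helical Navier–Stokes equations**
(Alexakis–Biferale §4.1.1: `∂ₜũ = Σ C ũ*ũ* − νk²ũ − αũ + f̃`), about the loaded leg `u_k ≡ A`:
`ḃ_p = C_p G b̄_q − μ_p b_p`, `ḃ_q = C_q G b̄_p − μ_q b_q`, with leg damping rates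
`μ_p = ν|p|²` (`+ α`), `μ_q = ν|q|²` (`+ α`) and `G = g Ā`. (For times short compared with the
viscous decay of the loaded leg itself; the typed object is this constant-coefficient system.)
[cite: AlexakisBiferale2018, §4.1.1–§4.1.2] -/
structure IsDampedLinearisedTriad (Cp Cq : ℝ) (G : ℂ) (μp μq : ℝ) (bp bq : ℝ → ℂ) : Prop where
  /-- `ḃ_p = C_p G b̄_q − μ_p b_p` -/
  hasDerivAt_p : ∀ t, HasDerivAt bp ((Cp : ℂ) * G * conj (bq t) - (μp : ℂ) * bp t) t
  /-- `ḃ_q = C_q G b̄_p − μ_q b_q` -/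
  hasDerivAt_q : ∀ t, HasDerivAt bq ((Cq : ℂ) * G * conj (bp t) - (μq : ℂ) * bq t) t

/-- Without damping the viscous linearised triad is the inviscid one.
[cite: AlexakisBiferale2018, §4.1.2] -/
theorem isDampedLinearisedTriad_zero_iff (Cp Cq : ℝ) (G : ℂ) (bp bq : ℝ → ℂ) :
    IsDampedLinearisedTriad Cp Cq G 0 0 bp bq ↔ IsLinearisedTriad Cp Cq G bp bq := by
  constructor
  · intro h
    exact ⟨fun t => (h.hasDerivAt_p t).congr_deriv (by push_cast; ring),
      fun t => (h.hasDerivAt_q t).congr_deriv (by push_cast; ring)⟩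
  · intro h
    exact ⟨fun t => (h.hasDerivAt_p t).congr_deriv (by push_cast; ring),
      fun t => (h.hasDerivAt_q t).congr_deriv (by push_cast; ring)⟩

namespace IsDampedLinearisedTriad

variable {Cp Cq : ℝ} {G : ℂ} {μp μq : ℝ} {bp bq : ℝ → ℂ}

/-- The overall sign of `(C_p, C_q, G)` is immaterial: `(−C_p)(−G) = C_p G`. (Used to reduce the
same-sign case `C_p C_q > 0` to `C_p, C_q > 0`.) [cite: AlexakisBiferale2018, §4.1.2] -/
theorem neg (h : IsDampedLinearisedTriad Cp Cq G μp μq bp bq) :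
    IsDampedLinearisedTriad (-Cp) (-Cq) (-G) μp μq bp bq where
  hasDerivAt_p t := (h.hasDerivAt_p t).congr_deriv (by push_cast; ring)
  hasDerivAt_q t := (h.hasDerivAt_q t).congr_deriv (by push_cast; ring)

/-- **Removing equal damping**: if both legs are damped at the same rate `μ` (e.g. `|p| = |q|`, as
for the cell's `(N; 2N, 2N)` seeds), then `e^{μt} b` solves the INVISCID linearised triad — the
damping decouples exactly, as for a Kelvin mode (`EllipticalInstability.IsKelvinMode.viscous`).
[cite: AlexakisBiferale2018, §4.1.1–§4.1.2] -/
theorem undamped {μ : ℝ} (h : IsDampedLinearisedTriad Cp Cq G μ μ bp bq) :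
    IsLinearisedTriad Cp Cq G (fun t => ((Real.exp (μ * t) : ℝ) : ℂ) * bp t)
      (fun t => ((Real.exp (μ * t) : ℝ) : ℂ) * bq t) := by
  have he : ∀ t, HasDerivAt (fun s => ((Real.exp (μ * s) : ℝ) : ℂ))
      (((Real.exp (μ * t) * μ : ℝ) : ℂ)) t := fun t => by
    have h := ((hasDerivAt_id t).const_mul μ).exp
    simpa [mul_comm] using h.ofReal_comp
  refine ⟨fun t => ((he t).mul (h.hasDerivAt_p t)).congr_deriv ?_,
    fun t => ((he t).mul (h.hasDerivAt_q t)).congr_deriv ?_⟩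
  · simp only [map_mul, Complex.conj_ofReal]; push_cast; ring
  · simp only [map_mul, Complex.conj_ofReal]; push_cast; ring

end IsDampedLinearisedTriad

/-- **Adding equal damping**: conversely `e^{−μt} b` turns an inviscid solution into a solution
damped at rate `μ` on both legs. [cite: AlexakisBiferale2018, §4.1.1–§4.1.2] -/
theorem IsLinearisedTriad.damped {Cp Cq : ℝ} {G : ℂ} {bp bq : ℝ → ℂ}
    (h : IsLinearisedTriad Cp Cq G bp bq) (μ : ℝ) :
    IsDampedLinearisedTriad Cp Cq G μ μ (fun t => ((Real.exp (-(μ * t)) : ℝ) : ℂ) * bp t)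
      (fun t => ((Real.exp (-(μ * t)) : ℝ) : ℂ) * bq t) := by
  have he : ∀ t, HasDerivAt (fun s => ((Real.exp (-(μ * s)) : ℝ) : ℂ))
      (((Real.exp (-(μ * t)) * (-μ) : ℝ) : ℂ)) t := fun t => by
    have h := ((hasDerivAt_id t).const_mul μ).neg.exp
    simpa [mul_comm] using h.ofReal_comp
  refine ⟨fun t => ((he t).mul (h.hasDerivAt_p t)).congr_deriv ?_,
    fun t => ((he t).mul (h.hasDerivAt_q t)).congr_deriv ?_⟩
  · simp only [map_mul, Complex.conj_ofReal]; push_cast; ring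
  · simp only [map_mul, Complex.conj_ofReal]; push_cast; ring

/-- Weighted AM–GM: `2√(C_p C_q) a b ≤ C_q a² + C_p b²` for `C_p, C_q > 0`. [folklore] -/
private theorem two_mul_sqrt_mul_le {Cp Cq : ℝ} (hp : 0 < Cp) (hq : 0 < Cq) (a b : ℝ) :
    2 * Real.sqrt (Cp * Cq) * a * b ≤ Cq * a ^ 2 + Cp * b ^ 2 := by
  set ρ := Real.sqrt (Cp * Cq) with hρ
  have hρ2 : ρ ^ 2 = Cp * Cq := Real.sq_sqrt (mul_pos hp hq).le
  have e : Cq * (Cq * a ^ 2 + Cp * b ^ 2 - 2 * ρ * a * b) = (Cq * a - ρ * b) ^ 2 := by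
    have : (Cq * a - ρ * b) ^ 2 = Cq ^ 2 * a ^ 2 - 2 * Cq * ρ * a * b + ρ ^ 2 * b ^ 2 := by ring
    rw [this, hρ2]; ring
  have h0 : 0 ≤ Cq * (Cq * a ^ 2 + Cp * b ^ 2 - 2 * ρ * a * b) := by rw [e]; exact sq_nonneg _
  have h1 : 0 ≤ Cq * a ^ 2 + Cp * b ^ 2 - 2 * ρ * a * b :=
    (mul_nonneg_iff_of_pos_left hq).mp h0
  linarith

namespace IsDampedLinearisedTriad

variable {Cp Cq : ℝ} {G : ℂ} {μp μq : ℝ} {bp bq : ℝ → ℂ}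

/-- **The weighted energy balance**: with `E = C_q|b_p|² + C_p|b_q|²`,
`Ė = 4 C_p C_q Re(G b̄_q b̄_p) − 2μ_p C_q|b_p|² − 2μ_q C_p|b_q|²`.
[cite: AlexakisBiferale2018, §4.1.2] -/
theorem hasDerivAt_weightedEnergy (h : IsDampedLinearisedTriad Cp Cq G μp μq bp bq) (t : ℝ) :
    HasDerivAt (fun s => Cq * ‖bp s‖ ^ 2 + Cp * ‖bq s‖ ^ 2)
      (4 * Cp * Cq * (G * conj (bq t) * conj (bp t)).re - 2 * μp * Cq * ‖bp t‖ ^ 2 -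
        2 * μq * Cp * ‖bq t‖ ^ 2) t := by
  have h1 := (hasDerivAt_norm_sq (h.hasDerivAt_p t)).const_mul Cq
  have h2 := (hasDerivAt_norm_sq (h.hasDerivAt_q t)).const_mul Cp
  refine (h1.add h2).congr_deriv ?_
  have np : (bp t * conj (bp t)).re = ‖bp t‖ ^ 2 := by
    rw [Complex.mul_conj, Complex.normSq_eq_norm_sq]; norm_cast
  have nq : (bq t * conj (bq t)).re = ‖bq t‖ ^ 2 := by
    rw [Complex.mul_conj, Complex.normSq_eq_norm_sq]; norm_cast
  have e1 : (((Cp : ℂ) * G * conj (bq t) - (μp : ℂ) * bp t) * conj (bp t)).re =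
      Cp * (G * conj (bq t) * conj (bp t)).re - μp * ‖bp t‖ ^ 2 := by
    rw [sub_mul, Complex.sub_re, show (Cp : ℂ) * G * conj (bq t) * conj (bp t) =
      (Cp : ℂ) * (G * conj (bq t) * conj (bp t)) by ring, Complex.re_ofReal_mul,
      show (μp : ℂ) * bp t * conj (bp t) = (μp : ℂ) * (bp t * conj (bp t)) by ring,
      Complex.re_ofReal_mul, np]
  have e2 : (((Cq : ℂ) * G * conj (bp t) - (μq : ℂ) * bq t) * conj (bq t)).re =
      Cq * (G * conj (bq t) * conj (bp t)).re - μq * ‖bq t‖ ^ 2 := by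
    rw [sub_mul, Complex.sub_re, show (Cq : ℂ) * G * conj (bp t) * conj (bq t) =
      (Cq : ℂ) * (G * conj (bq t) * conj (bp t)) by ring, Complex.re_ofReal_mul,
      show (μq : ℂ) * bq t * conj (bq t) = (μq : ℂ) * (bq t * conj (bq t)) by ring,
      Complex.re_ofReal_mul, nq]
  rw [e1, e2]; ring

/-- **The sharp energy ceiling with damping** ("the linear factor
`exp(2(σ_pair − ν|p|²)(t_read − t_inj))`" of the cell's channel words): for `C_p, C_q > 0` and
both legs damped at rate at least `μ`, the weighted energy of the two seeded legs obeys
`C_q|b_p(t)|² + C_p|b_q(t)|² ≤ (C_q|b_p(0)|² + C_p|b_q(0)|²) · e^{2(σ − μ)t}` for `t ≥ 0`,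
`σ = |G|√(C_p C_q)` (`growthRate`); sharp when `μ_p = μ_q = μ` (`isDampedLinearisedTriad_growing`).
[cite: AlexakisBiferale2018, §4.1.1–§4.1.2] -/
theorem weightedEnergy_le_exp (h : IsDampedLinearisedTriad Cp Cq G μp μq bp bq) (hp : 0 < Cp)
    (hq : 0 < Cq) {μ : ℝ} (hμp : μ ≤ μp) (hμq : μ ≤ μq) {t : ℝ} (ht : 0 ≤ t) :
    Cq * ‖bp t‖ ^ 2 + Cp * ‖bq t‖ ^ 2 ≤
      (Cq * ‖bp 0‖ ^ 2 + Cp * ‖bq 0‖ ^ 2) * Real.exp (2 * (growthRate Cp Cq G - μ) * t) := by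
  set σ := growthRate Cp Cq G with hσ
  set E : ℝ → ℝ := fun s => Cq * ‖bp s‖ ^ 2 + Cp * ‖bq s‖ ^ 2 with hE
  -- `F(s) = E(s) e^{−2(σ−μ)s}` is non-increasing
  set F : ℝ → ℝ := fun s => E s * Real.exp (-(2 * (σ - μ) * s)) with hF
  have hd : ∀ s, HasDerivAt F
      ((4 * Cp * Cq * (G * conj (bq s) * conj (bp s)).re - 2 * μp * Cq * ‖bp s‖ ^ 2 -
          2 * μq * Cp * ‖bq s‖ ^ 2) * Real.exp (-(2 * (σ - μ) * s)) +
        E s * (Real.exp (-(2 * (σ - μ) * s)) * -(2 * (σ - μ)))) s := fun s => by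
    have he : HasDerivAt (fun s => Real.exp (-(2 * (σ - μ) * s)))
        (Real.exp (-(2 * (σ - μ) * s)) * -(2 * (σ - μ))) s := by
      have := ((hasDerivAt_id s).const_mul (2 * (σ - μ))).neg.exp
      simpa [mul_comm] using this
    exact (h.hasDerivAt_weightedEnergy s).mul he
  have hanti : Antitone F := by
    refine antitone_of_deriv_nonpos (fun s => (hd s).differentiableAt) fun s => ?_
    rw [(hd s).deriv]
    set a := ‖bp s‖ with ha
    set b := ‖bq s‖ with hb
    set R := (G * conj (bq s) * conj (bp s)).re with hR
    have hRle : R ≤ ‖G‖ * b * a := by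
      have := Complex.re_le_norm (G * conj (bq s) * conj (bp s))
      rwa [norm_mul, norm_mul, Complex.norm_conj, Complex.norm_conj] at this
    have hρ : 2 * Real.sqrt (Cp * Cq) * a * b ≤ Cq * a ^ 2 + Cp * b ^ 2 :=
      two_mul_sqrt_mul_le hp hq a b
    have hρ0 : 0 ≤ Real.sqrt (Cp * Cq) := Real.sqrt_nonneg _
    have hρ2 : Real.sqrt (Cp * Cq) ^ 2 = Cp * Cq := Real.sq_sqrt (mul_pos hp hq).le
    have hG0 : 0 ≤ ‖G‖ := norm_nonneg G
    -- cross term ≤ 2σE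
    have hcross : 4 * Cp * Cq * R ≤ 2 * σ * (Cq * a ^ 2 + Cp * b ^ 2) := by
      have h1 : 4 * Cp * Cq * R ≤ 4 * Cp * Cq * (‖G‖ * b * a) :=
        mul_le_mul_of_nonneg_left hRle (by positivity)
      have h2 : 4 * Cp * Cq * (‖G‖ * b * a) =
          2 * (‖G‖ * Real.sqrt (Cp * Cq)) * (2 * Real.sqrt (Cp * Cq) * a * b) := by
        have : 4 * Cp * Cq * (‖G‖ * b * a) = 2 * ‖G‖ * (2 * (Real.sqrt (Cp * Cq)) ^ 2 * a * b) := by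
          rw [hρ2]; ring
        rw [this]; ring
      have h3 : 2 * (‖G‖ * Real.sqrt (Cp * Cq)) * (2 * Real.sqrt (Cp * Cq) * a * b) ≤
          2 * (‖G‖ * Real.sqrt (Cp * Cq)) * (Cq * a ^ 2 + Cp * b ^ 2) :=
        mul_le_mul_of_nonneg_left hρ (by positivity)
      rw [hσ, growthRate]
      linarith
    -- damping term ≤ −2μE
    have hdamp : -(2 * μp * Cq * a ^ 2) - 2 * μq * Cp * b ^ 2 ≤ -(2 * μ * (Cq * a ^ 2 + Cp * b ^ 2)) := by
      have h1 : μ * (Cq * a ^ 2) ≤ μp * (Cq * a ^ 2) :=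
        mul_le_mul_of_nonneg_right hμp (by positivity)
      have h2 : μ * (Cp * b ^ 2) ≤ μq * (Cp * b ^ 2) :=
        mul_le_mul_of_nonneg_right hμq (by positivity)
      linarith
    have hE' : 4 * Cp * Cq * R - 2 * μp * Cq * a ^ 2 - 2 * μq * Cp * b ^ 2 ≤
        2 * (σ - μ) * (Cq * a ^ 2 + Cp * b ^ 2) := by linarith
    have hEs : E s = Cq * a ^ 2 + Cp * b ^ 2 := rfl
    rw [hEs]
    have hex : 0 < Real.exp (-(2 * (σ - μ) * s)) := Real.exp_pos _
    nlinarith [mul_le_mul_of_nonneg_right hE' hex.le]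
  have hF0 : F t ≤ F 0 := hanti ht
  simp only [hF, mul_zero, neg_zero, Real.exp_zero, mul_one] at hF0
  have hEt : E t = E t * Real.exp (-(2 * (σ - μ) * t)) * Real.exp (2 * (σ - μ) * t) := by
    rw [mul_assoc, ← Real.exp_add]; simp
  show E t ≤ E 0 * Real.exp (2 * (σ - μ) * t)
  rw [hEt]
  exact mul_le_mul_of_nonneg_right hF0 (Real.exp_pos _).le

/-- **SUB-VISCOUS ⇒ no linear growth.** If `σ ≤ μ ≤ μ_p, μ_q` ("σ_pair ≤ ν|p|²" with `|p| ≤ |q|`: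
the channel word SUB-VISCOUS of the cell's pre-registration), the weighted energy of the seeded
legs never exceeds its initial value. [cite: AlexakisBiferale2018, §4.1.1–§4.1.2] -/
theorem weightedEnergy_le_of_subviscous (h : IsDampedLinearisedTriad Cp Cq G μp μq bp bq)
    (hp : 0 < Cp) (hq : 0 < Cq) {μ : ℝ} (hσ : growthRate Cp Cq G ≤ μ) (hμp : μ ≤ μp)
    (hμq : μ ≤ μq) {t : ℝ} (ht : 0 ≤ t) :
    Cq * ‖bp t‖ ^ 2 + Cp * ‖bq t‖ ^ 2 ≤ Cq * ‖bp 0‖ ^ 2 + Cp * ‖bq 0‖ ^ 2 := by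
  have hb := h.weightedEnergy_le_exp hp hq hμp hμq ht
  have hex : Real.exp (2 * (growthRate Cp Cq G - μ) * t) ≤ 1 :=
    Real.exp_le_one_iff.2 (by nlinarith)
  have hE0 : 0 ≤ Cq * ‖bp 0‖ ^ 2 + Cp * ‖bq 0‖ ^ 2 := by positivity
  calc Cq * ‖bp t‖ ^ 2 + Cp * ‖bq t‖ ^ 2
      ≤ (Cq * ‖bp 0‖ ^ 2 + Cp * ‖bq 0‖ ^ 2) * Real.exp (2 * (growthRate Cp Cq G - μ) * t) := hb
    _ ≤ (Cq * ‖bp 0‖ ^ 2 + Cp * ‖bq 0‖ ^ 2) * 1 := mul_le_mul_of_nonneg_left hex hE0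
    _ = _ := mul_one _

end IsDampedLinearisedTriad

/-- `growthRate` is invariant under the overall sign flip `(C_p, C_q, G) ↦ (−C_p, −C_q, −G)`.
[cite: AlexakisBiferale2018, §4.1.2] -/
theorem growthRate_neg (Cp Cq : ℝ) (G : ℂ) : growthRate (-Cp) (-Cq) (-G) = growthRate Cp Cq G := by
  simp [growthRate, norm_neg]

/-- **The inviscid ceiling is the growth rate `σ`** (sharp by `isLinearisedTriad_growing`): for
`C_p C_q > 0`, `|C_q||b_p(t)|² + |C_p||b_q(t)|² ≤ (|C_q||b_p(0)|² + |C_p||b_q(0)|²) e^{2σt}`,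
`t ≥ 0` — no perturbation of the loaded leg outgrows `σ = |G|√(C_p C_q)`.
[cite: AlexakisBiferale2018, §4.1.2] -/
theorem IsLinearisedTriad.weightedEnergy_le_exp {Cp Cq : ℝ} {G : ℂ} {bp bq : ℝ → ℂ}
    (h : IsLinearisedTriad Cp Cq G bp bq) (hC : 0 < Cp * Cq) {t : ℝ} (ht : 0 ≤ t) :
    |Cq| * ‖bp t‖ ^ 2 + |Cp| * ‖bq t‖ ^ 2 ≤
      (|Cq| * ‖bp 0‖ ^ 2 + |Cp| * ‖bq 0‖ ^ 2) * Real.exp (2 * growthRate Cp Cq G * t) := by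
  have h0 := (isDampedLinearisedTriad_zero_iff Cp Cq G bp bq).2 h
  rcases lt_or_gt_of_ne (show Cp ≠ 0 by rintro rfl; simp at hC) with hp | hp
  · have hq : Cq < 0 := by nlinarith
    have hb := h0.neg.weightedEnergy_le_exp (neg_pos.2 hp) (neg_pos.2 hq) le_rfl le_rfl ht
    rw [growthRate_neg, sub_zero] at hb
    rw [abs_of_neg hp, abs_of_neg hq]
    exact hb
  · have hq : 0 < Cq := by nlinarith
    have hb := h0.weightedEnergy_le_exp hp hq le_rfl le_rfl ht
    rw [sub_zero] at hb
    rw [abs_of_pos hp, abs_of_pos hq]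
    exact hb

/-- **The damped growth rate**: the larger root `λ` of the dispersion relation
`(λ + μ_p)(λ + μ_q) = σ²` of the viscous linearised triad,
`λ = −(μ_p + μ_q)/2 + √(σ² + (μ_p − μ_q)²/4)`. [cite: AlexakisBiferale2018, §4.1.1–§4.1.2] -/
def dampedGrowthRate (Cp Cq : ℝ) (G : ℂ) (μp μq : ℝ) : ℝ :=
  -((μp + μq) / 2) + Real.sqrt (growthRate Cp Cq G ^ 2 + ((μp - μq) / 2) ^ 2)

/-- The dispersion relation `(λ + μ_p)(λ + μ_q) = σ²`.
[cite: AlexakisBiferale2018, §4.1.1–§4.1.2] -/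
theorem dampedGrowthRate_dispersion (Cp Cq : ℝ) (G : ℂ) (μp μq : ℝ) :
    (dampedGrowthRate Cp Cq G μp μq + μp) * (dampedGrowthRate Cp Cq G μp μq + μq) =
      growthRate Cp Cq G ^ 2 := by
  unfold dampedGrowthRate
  set D := growthRate Cp Cq G ^ 2 + ((μp - μq) / 2) ^ 2 with hD
  have hD0 : 0 ≤ D := by positivity
  have hs : Real.sqrt D ^ 2 = D := Real.sq_sqrt hD0
  nlinarith [hs]

/-- **Equal damping shifts the rate exactly**: `λ(μ, μ) = σ − μ` — for `|p| = |q|` the viscous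
`σ_pair` is the inviscid one minus `ν|p|²`. [cite: AlexakisBiferale2018, §4.1.1–§4.1.2] -/
theorem dampedGrowthRate_of_eq (Cp Cq : ℝ) (G : ℂ) (μ : ℝ) :
    dampedGrowthRate Cp Cq G μ μ = growthRate Cp Cq G - μ := by
  unfold dampedGrowthRate
  have hσ : 0 ≤ growthRate Cp Cq G := mul_nonneg (norm_nonneg _) (Real.sqrt_nonneg _)
  rw [sub_self, zero_div, zero_pow two_ne_zero, add_zero, Real.sqrt_sq hσ]
  ring

/-- **The viscous threshold**: with non-negative leg dampings the damped triad grows (`λ > 0`)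
iff `μ_p μ_q < σ²`, i.e. iff `ν²|p|²|q|² < C_p C_q |G|²`. [cite: AlexakisBiferale2018, §4.1.1–§4.1.2] -/
theorem dampedGrowthRate_pos_iff {Cp Cq : ℝ} {G : ℂ} {μp μq : ℝ} (hμp : 0 ≤ μp) (hμq : 0 ≤ μq) :
    0 < dampedGrowthRate Cp Cq G μp μq ↔ μp * μq < growthRate Cp Cq G ^ 2 := by
  unfold dampedGrowthRate
  set σ := growthRate Cp Cq G with hσ
  set D := σ ^ 2 + ((μp - μq) / 2) ^ 2 with hD
  have hD0 : 0 ≤ D := by positivity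
  have hm : 0 ≤ (μp + μq) / 2 := by positivity
  rw [neg_add_eq_sub, sub_pos, Real.lt_sqrt hm]
  constructor <;> intro h <;> nlinarith [h]

/-- **The damped triad still has an exponential solution**: for `C_p C_q > 0`, `G ≠ 0` and any leg
dampings, `b_p = e^{λt}`, `b_q = ((λ + μ_p)/(C_p Ḡ)) e^{λt}` with `λ = dampedGrowthRate` solves the
viscous linearised triad (growth iff `λ > 0`, `dampedGrowthRate_pos_iff`).
[cite: AlexakisBiferale2018, §4.1.1–§4.1.2] -/
theorem isDampedLinearisedTriad_growing {Cp Cq : ℝ} {G : ℂ} (hC : 0 < Cp * Cq) (hG : G ≠ 0)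
    (μp μq : ℝ) :
    IsDampedLinearisedTriad Cp Cq G μp μq
      (fun t => ((Real.exp (dampedGrowthRate Cp Cq G μp μq * t) : ℝ) : ℂ))
      (fun t => ((dampedGrowthRate Cp Cq G μp μq + μp : ℝ) : ℂ) / ((Cp : ℂ) * conj G) *
        ((Real.exp (dampedGrowthRate Cp Cq G μp μq * t) : ℝ) : ℂ)) := by
  set lam := dampedGrowthRate Cp Cq G μp μq with hlam
  have hCp : (Cp : ℂ) ≠ 0 := by
    have : Cp ≠ 0 := by rintro rfl; simp at hC
    exact_mod_cast this
  have hGc : conj G ≠ 0 := by simpa using hG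
  have hden : (Cp : ℂ) * conj G ≠ 0 := mul_ne_zero hCp hGc
  have hdisp : ((lam : ℂ) + μp) * ((lam : ℂ) + μq) = (Cp : ℂ) * Cq * (G * conj G) := by
    have h1 : (lam + μp) * (lam + μq) = growthRate Cp Cq G ^ 2 :=
      dampedGrowthRate_dispersion Cp Cq G μp μq
    have h2 : growthRate Cp Cq G ^ 2 = Cp * Cq * ‖G‖ ^ 2 := growthRate_sq G hC.le
    have : (((lam + μp) * (lam + μq) : ℝ) : ℂ) = ((Cp * Cq * ‖G‖ ^ 2 : ℝ) : ℂ) := by rw [h1, h2]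
    push_cast at this
    have hGG : ((‖G‖ : ℂ)) ^ 2 = G * conj G := by
      rw [← Complex.ofReal_pow, Complex.mul_conj, Complex.normSq_eq_norm_sq]
    rw [this, hGG]
  have he : ∀ t, HasDerivAt (fun s => ((Real.exp (lam * s) : ℝ) : ℂ))
      (((Real.exp (lam * t) * lam : ℝ) : ℂ)) t := fun t => by
    have h := ((hasDerivAt_id t).const_mul lam).exp
    simpa [mul_comm] using h.ofReal_comp
  refine ⟨fun t => (he t).congr_deriv ?_, fun t => ((he t).const_mul _).congr_deriv ?_⟩
  · -- `λ e^{λt} = C_p G conj(b_q) − μ_p b_p`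
    simp only [map_mul, map_div₀, Complex.conj_ofReal, Complex.conj_conj]
    rw [Complex.ofReal_mul]
    field_simp
    push_cast
    ring
  · -- `((λ+μ_p)/(C_p Ḡ)) λ e^{λt} = C_q G conj(b_p) − μ_q b_q`
    simp only [Complex.conj_ofReal]
    rw [Complex.ofReal_mul]
    field_simp
    push_cast
    linear_combination hdisp

/-! ### §6 The cell's E.2 seed geometry `(N; 2N, 2N)`: `σ_pair = √3 N |G|`, damping `4νN²` on both legs -/

/-- **E.2 coefficients**: for the isosceles triad with the loaded carrier of modulus `N` and two
HETEROCHIRAL legs of modulus `2N` (`s_p = −s_q`), `C_p C_q = 3N²` whatever the carrier's sign —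
the smallest-leg heterochiral (class III–IV) instability of `coeff_mul_pos_iff_of_smallest`, made
quantitative. [cite: AlexakisBiferale2018, §4.1.2] -/
theorem coeff_mul_isosceles_heterochiral {sk sq : ℝ} (hsk : sk = 1 ∨ sk = -1)
    (hsq : sq = 1 ∨ sq = -1) (N : ℝ) :
    coeffP sk sq N (2 * N) * coeffQ sk (-sq) N (2 * N) = 3 * N ^ 2 := by
  rcases hsk with rfl | rfl <;> rcases hsq with rfl | rfl <;> simp only [coeffP, coeffQ] <;> ring

/-- The HOMOCHIRAL isosceles seed (`s_p = s_q`) is linearly stable: `C_p C_q = −(2 s_q − s_k)² N² ≤ 0`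
(it is `−N²` or `−9N²`). [cite: AlexakisBiferale2018, §4.1.2] -/
theorem coeff_mul_isosceles_homochiral {sk sq : ℝ} (hsk : sk = 1 ∨ sk = -1)
    (hsq : sq = 1 ∨ sq = -1) (N : ℝ) :
    coeffP sk sq N (2 * N) * coeffQ sk sq N (2 * N) = -((2 * sq - sk) ^ 2 * N ^ 2) := by
  rcases hsk with rfl | rfl <;> rcases hsq with rfl | rfl <;> simp only [coeffP, coeffQ] <;> ring

/-- **`σ_pair` of the E.2 seed**: `σ = |G| √3 |N|` (`G = g Ā` the loaded carrier's coupling).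
[cite: AlexakisBiferale2018, §4.1.2] -/
theorem growthRate_isosceles_heterochiral {sk sq : ℝ} (hsk : sk = 1 ∨ sk = -1)
    (hsq : sq = 1 ∨ sq = -1) (N : ℝ) (G : ℂ) :
    growthRate (coeffP sk sq N (2 * N)) (coeffQ sk (-sq) N (2 * N)) G = ‖G‖ * (Real.sqrt 3 * |N|) := by
  rw [growthRate, coeff_mul_isosceles_heterochiral hsk hsq, Real.sqrt_mul (by norm_num : (0:ℝ) ≤ 3),
    Real.sqrt_sq_eq_abs]

/-- **The E.2 channel rate with viscosity**: both legs have modulus `2N`, hence the same damping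
`μ = ν(2N)² = 4νN²`, and the damped rate is exactly `λ = √3 |N| |G| − 4νN²`
(`dampedGrowthRate_of_eq`); the channel is SUB-VISCOUS (`λ ≤ 0`) iff `√3 |N| |G| ≤ 4νN²`.
[cite: AlexakisBiferale2018, §4.1.1–§4.1.2] -/
theorem dampedGrowthRate_isosceles_heterochiral {sk sq : ℝ} (hsk : sk = 1 ∨ sk = -1)
    (hsq : sq = 1 ∨ sq = -1) (N ν : ℝ) (G : ℂ) :
    dampedGrowthRate (coeffP sk sq N (2 * N)) (coeffQ sk (-sq) N (2 * N)) G (ν * (2 * N) ^ 2)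
        (ν * (2 * N) ^ 2) = Real.sqrt 3 * |N| * ‖G‖ - 4 * ν * N ^ 2 := by
  rw [dampedGrowthRate_of_eq, growthRate_isosceles_heterochiral hsk hsq]
  ring

end HelicalTriad

end Literature.Analysis.FluidPDE
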